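import Literature.IUT.HodgeArakelov.EtaleThetaDataOfSetting
import Literature.AnabelianGeometry.EtaleTheta.RigidOfSetting

/-!
# [IUTchII] Prop 1.4 bridge: the hypothesis `PiYddCharacteristic` IS [EtTh] Cor 2.18 (i) (proof-only)

Mochizuki, *Inter-universal Teichmüller theory II*, kurims manuscript (Dec. 2020), Prop. 1.4 p. 27: "the open
subgroup `Π_Ÿ(Π) ⊆ Π` corresponding to the tempered covering `Ÿ`" [claim: Mochizuki2012, status: disputed] — typed
by abc-iut-L6-t1 as the interface clause `EtaleThetaData.PiYdd_corresponds` (every `Π ≅ Π^tp_{X̲̲_k}` carries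
`Π_Ÿ(Π)` to the reference subgroup) and, at the [EtTh] model `Π = Π^tp_X̲̲` of the bridge
`Literature.IUT.HodgeArakelov.etaleThetaDataOfSetting` (p411758/p412136), reduced to the ONE named hypothesis
`EtaleThetaDataOfSetting.PiYddCharacteristic C`: every topological automorphism of `Π^tp_X̲̲` stabilises
`Π^tp_Ÿ̲̲ = Π^tp_Ÿ ∩ Π^tp_X̲̲`. S. Mochizuki, *The étale theta function …* [EtTh], Publ. RIMS **45** (2009), §2,
Corollary 2.18 (i), PRIMS PDF pp. 59–60 (printed pp. 285–286; bib key `MochizukiEtTh2009`): the subquotients `Π^tp_Y`, `Π^tp_Ÿ`, … of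
`Π^tp_X̲̲` "may be constructed via a functorial group-theoretic algorithm … which has the property that any
isomorphism … maps [them] to [the corresponding subquotients]".

PROOF-ONLY companion (abc-iut cell, D-0067 wave 4, seat abc-iut-w4-d013; RQ7 finding F2 on p411758, acknowledged
by abc-iut-L6-t1 23:33:40Z «F2 = d013 files the L2 discharge»). It shows that the bridge's hypothesis is NOT a new
fact: at abc-iut-L2-t8's §1 instantiation `C.rigidData μ hC hS h15 L` of the [EtTh] §2 rigidity interface
(`RigidOfSetting.lean`; `PiX := C.Huu = Π^tp_X̲̲`, `PiYdd := Π^tp_Ÿ.subgroupOf Π^tp_X̲̲`), `PiYddCharacteristic C` is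
LITERALLY the `Π^tp_Ÿ`-conjunct of abc-iut-L2-t2's named FACT `RigidData.Cor218_i` (`ThetaRigidity.lean`; cell
FOUNDATIONS row 39 / FACT-policy: [EtTh] Cor. 2.18 is consumed BY NAME under campaign M) — so the hypothesis is
discharged MODULO that FACT (D-0067 (5): inputs by name from the FACT list, no new `Prop` facts). Idiom of
`Literature/AnabelianGeometry/EtaleTheta/Discharge/Sec2Cor218ivOfSetting.lean` (`hR : R = C.rigidData …`).
Nothing here asserts [EtTh] Cor. 2.18 (i) or any disputed claim; no side is taken on [IUTchIII] Cor. 3.12;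
typed ≠ proved.
-/

noncomputable section

namespace Literature.AnabelianGeometry.EtaleTheta

universe u

namespace RigidData

variable {N : ℕ+} {l : ℕ} (R : RigidData.{u} N l)

/-- **[EtTh] Cor. 2.18 (i), the `Π^tp_Ÿ`-clause** (projection of abc-iut-L2-t2's typed conjunction `Cor218_i`):
every topological automorphism `γ` of `Π^tp_X̲̲` satisfies `γ(Π^tp_Ÿ) = Π^tp_Ÿ`. [cite: MochizukiEtTh2009, Cor 2.18(i) pp.59–60] -/
theorem map_PiYdd_eq_of_cor218_i (h218i : R.Cor218_i) (γ : R.PiX ≃ₜ* R.PiX) :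
    R.PiYdd.map γ.toMulEquiv.toMonoidHom = R.PiYdd :=
  (h218i γ).2.1

/-- **[EtTh] Cor. 2.18 (i), the `Π^tp_Y`-clause** (same projection). [cite: MochizukiEtTh2009, Cor 2.18(i) pp.59–60] -/
theorem map_PiY_eq_of_cor218_i (h218i : R.Cor218_i) (γ : R.PiX ≃ₜ* R.PiX) :
    R.PiY.map γ.toMulEquiv.toMonoidHom = R.PiY :=
  (h218i γ).1

end RigidData

namespace ThetaSetting.EtaleThetaData.DoubleUnderline

variable {p : ℕ} [Fact p.Prime] {D : ThetaSetting p} {E : D.EtaleThetaData} {l : ℕ}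
  (C : E.DoubleUnderline l) {N : ℕ+} (μ : D.CyclotomeMod l N)

/-- `Π^tp_Ÿ̲̲ = Π^tp_Ÿ ∩ Π^tp_X̲̲` read inside `Π^tp_X̲̲` (the bridge's `EtaleThetaDataOfSetting.PiYdd C`) IS the field
`PiYdd` of abc-iut-L2-t8's instantiated [EtTh] §2 data `thetaEnvData` (`PiYdd := Π^tp_Ÿ.subgroupOf Π^tp_X̲̲`).
[cite: MochizukiEtTh2009, Def 2.13 p.47] -/
theorem gtpYdduu_subgroupOf_eq (hC : D.Compat) (hS : D.Sec2Hyps) :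
    C.GtpYdduu.subgroupOf C.Huu = (C.thetaEnvData μ hC hS).PiYdd := by
  change (D.GtpYdd ⊓ C.Huu).subgroupOf C.Huu = D.GtpYdd.subgroupOf C.Huu
  rw [inf_comm, Subgroup.inf_subgroupOf_left]

/-- **[EtTh] Cor. 2.18 (i) for the §1 model `Π^tp_X̲̲ = C.Huu`**: under the named FACT `Cor218_i` for
`R = C.rigidData μ hC hS h15 L`, every topological automorphism `α` of `Π^tp_X̲̲` stabilises
`Π^tp_Ÿ̲̲ = Π^tp_Ÿ ∩ Π^tp_X̲̲`. [cite: MochizukiEtTh2009, Cor 2.18(i) pp.59–60] -/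
theorem map_gtpYdduu_subgroupOf_eq_of_cor218_i (hC : D.Compat) (hS : D.Sec2Hyps)
    (h15 : Prop15iii E hC) (L : C.CuspLabels) (R : RigidData.{0} N l)
    (hR : R = C.rigidData μ hC hS h15 L) (h218i : R.Cor218_i) (α : ↥C.Huu ≃ₜ* ↥C.Huu) :
    (C.GtpYdduu.subgroupOf C.Huu).map α.toMulEquiv.toMonoidHom = C.GtpYdduu.subgroupOf C.Huu := by
  subst hR
  rw [C.gtpYdduu_subgroupOf_eq μ hC hS]
  exact RigidData.map_PiYdd_eq_of_cor218_i _ h218i α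

end ThetaSetting.EtaleThetaData.DoubleUnderline

end Literature.AnabelianGeometry.EtaleTheta

namespace Literature.IUT.HodgeArakelov

open Literature.AnabelianGeometry.EtaleTheta

namespace EtaleThetaDataOfSetting

variable {p : ℕ} [Fact p.Prime] {D : Literature.AnabelianGeometry.EtaleTheta.ThetaSetting p}
  {E : D.EtaleThetaData} {l : ℕ} (C : E.DoubleUnderline l) {N : ℕ+} (μ : D.CyclotomeMod l N)

/-- **IUTchII:Prop1.4** (kurims p. 27) — the bridge hypothesis **(H1) `PiYddCharacteristic C` DISCHARGED MODULO
[EtTh] Cor. 2.18 (i)**: "`Π_Ÿ(Π)` corresponding to the tempered covering `Ÿ`" at the model `Π = Π^tp_X̲̲` follows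
from abc-iut-L2-t2's named FACT `RigidData.Cor218_i` for abc-iut-L2-t8's `R = C.rigidData μ hC hS h15 L` (the
FACT is a hypothesis; nothing is asserted). [claim: Mochizuki2012, status: disputed] -/
theorem piYddCharacteristic_of_cor218_i (hC : D.Compat) (hS : D.Sec2Hyps) (h15 : D.Prop15iii E hC)
    (L : C.CuspLabels) (R : RigidData.{0} N l) (hR : R = C.rigidData μ hC hS h15 L)
    (h218i : R.Cor218_i) : PiYddCharacteristic C :=
  fun α => C.map_gtpYdduu_subgroupOf_eq_of_cor218_i μ hC hS h15 L R hR h218i α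

end EtaleThetaDataOfSetting

end Literature.IUT.HodgeArakelov

end
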